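import Summits.CriticalPhenomena.CardyFormulaZ2.Theorems.CardyIKTransportIKLinearTransportSDECore1
import Summits.CriticalPhenomena.CardyFormulaZ2.Theorems.CardyIKTransportIKLinearTransportDiagramExchangeGlue

/-!
# Stub `stub_StripDiagramExchange` — core part 2: the cylinder inside the strip

Continues `…SDECore1` (line `pinned-diagram-exchange`, crux stmt-CriticalPhenomena-5076). The closed form of the
window law; the cylinder `ℤ/N` READ OFF the strip window `[a, a+N] ∋ 0` under the periodicity event `SDE.Per a N`
(equal seam rows): its law is `K_N ·` block weight (`SDE.P_cyl`, the free corner-field weight of a periodic window IS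
the cyclic block weight), and block-weight sums over events constraining only the boundary colourings and prescribing
boundary connections are sums of pinned weights, so that `DiagramExchangeAt N` exchanges the two column-type orders
for such cylinder events (`SDE.P_cyl_exchange`).
-/

set_option autoImplicit false

noncomputable section

namespace Summit.CriticalPhenomena.CardyFormulaZ2.Theorems.IKLinearTransport.PinnedDiagramExchange

open scoped Classical MeasureTheory ENNReal ProbabilityTheory BigOperators
open MeasureTheory Literature.Probability.Percolation Literature.Probability.LatticeModels

namespace SDE

/-! ## §5 The closed form of the window law -/

/-- The single-bit factor of the window law. [folklore] -/
def gw (τ κ₀ : Bool) (v : Fin 3 → ℤ → Bool) (α : Fin 2 → ℤ → Bool) (j : Idx) : ℝ :=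
  if bits τ κ₀ v α j then (wt j.1 : ℝ) else 1 - wt j.1

/-- `gw ≥ 0`. [folklore] -/
theorem gw_nonneg (τ κ₀ : Bool) (v : Fin 3 → ℤ → Bool) (α : Fin 2 → ℤ → Bool) (j : Idx) : 0 ≤ gw τ κ₀ v α j := by
  unfold gw; split_ifs; exacts [(wt j.1).2.1, sub_nonneg.2 (wt j.1).2.2]

/-- Fair bits contribute `1/2`. [folklore] -/
theorem gw_fair (τ κ₀ : Bool) (v : Fin 3 → ℤ → Bool) (α : Fin 2 → ℤ → Bool) (k : Fin 5) (hk : k ≠ 1) (y : ℤ) :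
    gw τ κ₀ v α (k, y) = 1 / 2 := by
  unfold gw wt
  rw [if_neg hk, coe_half]
  split_ifs <;> norm_num

/-- Isotropic plaquette bits contribute `q` or `1 - q`. [folklore] -/
theorem gw_one (τ κ₀ : Bool) (v : Fin 3 → ℤ → Bool) (α : Fin 2 → ℤ → Bool) (y : ℤ) :
    gw τ κ₀ v α (1, y) = if oI τ v y then (qI : ℝ) else 1 - qI := by
  unfold gw wt
  rw [bits_one, if_pos rfl]

/-- THE WINDOW LAW (closed form): `(1/2)^{#rows+1} (1/4)^{#faces} ∏_{faces} q^{odd} (1-q)^{even}`. [folklore] -/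
theorem prod_Jw (τ κ₀ : Bool) {lo hi : ℤ} (hlh : lo ≤ hi) (v : Fin 3 → ℤ → Bool) (α : Fin 2 → ℤ → Bool) :
    ∏ j ∈ Jw lo hi, ENNReal.ofReal (if bits τ κ₀ v α j then (wt j.1 : ℝ) else 1 - wt j.1) =
      ENNReal.ofReal ((1 / 2) ^ ((hi - lo).toNat + 2) * (1 / 4) ^ (hi - lo).toNat *
        ∏ y ∈ Finset.Ico lo hi, (if oI τ v y then (qI : ℝ) else 1 - qI)) := by
  change ∏ j ∈ Jw lo hi, ENNReal.ofReal (gw τ κ₀ v α j) = _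
  rw [← ENNReal.ofReal_prod_of_nonneg fun j _ => gw_nonneg τ κ₀ v α j]
  congr 1
  have hd1 : Disjoint ({((4 : Fin 5), (1 : ℤ))} : Finset Idx) (({1, 2, 3} : Finset (Fin 5)) ×ˢ Finset.Ico lo hi) := by
    rw [Finset.disjoint_singleton_left]; simp
  have hd2 : Disjoint (({(0 : Fin 5)} : Finset (Fin 5)) ×ˢ Finset.Icc lo hi)
      ({((4 : Fin 5), (1 : ℤ))} ∪ (({1, 2, 3} : Finset (Fin 5)) ×ˢ Finset.Ico lo hi)) := by
    rw [Finset.disjoint_left]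
    rintro ⟨k, y⟩ h1 h2
    simp only [Finset.mem_product, Finset.mem_singleton] at h1
    simp only [Finset.mem_union, Finset.mem_singleton, Prod.mk.injEq, Finset.mem_product, Finset.mem_insert] at h2
    rcases h2 with ⟨h, -⟩ | ⟨h, -⟩ <;> rw [h1.1] at h <;> revert h <;> decide
  rw [Jw, Finset.prod_union hd2, Finset.prod_union hd1, Finset.prod_singleton, Finset.prod_product,
    Finset.prod_product, Finset.prod_singleton, Finset.prod_insert (by decide), Finset.prod_insert (by decide),
    Finset.prod_singleton]
  rw [Finset.prod_congr rfl fun y _ => gw_fair τ κ₀ v α 0 (by decide) y,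
    Finset.prod_congr rfl fun y _ => gw_fair τ κ₀ v α 2 (by decide) y,
    Finset.prod_congr rfl fun y _ => gw_fair τ κ₀ v α 3 (by decide) y,
    Finset.prod_congr rfl fun y _ => gw_one τ κ₀ v α y, gw_fair τ κ₀ v α 4 (by decide)]
  rw [Finset.prod_const, Finset.prod_const, Int.card_Icc, Int.card_Ico,
    show (hi + 1 - lo).toNat = (hi - lo).toNat + 1 by omega]
  have e4 : ((1 : ℝ) / 4) ^ (hi - lo).toNat = (1 / 2) ^ (hi - lo).toNat * (1 / 2) ^ (hi - lo).toNat := by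
    rw [← mul_pow]; norm_num
  rw [e4]; ring

/-! ## §6 The cylinder `ℤ/N` read off the strip window `[a, a+N]` -/

/-- Strip row of a cylinder row. [folklore] -/
def rowOf (a : ℤ) {N : ℕ} (r : ZMod N) : ℤ := a + (r.val : ℤ)

/-- Cylinder row of a strip row. [folklore] -/
def zOf (a : ℤ) (N : ℕ) (y : ℤ) : ZMod N := ((y - a : ℤ) : ZMod N)

/-- `zOf ∘ rowOf = id`. [folklore] -/
theorem zOf_rowOf (a : ℤ) {N : ℕ} [NeZero N] (r : ZMod N) : zOf a N (rowOf a r) = r := by simp [zOf, rowOf]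

/-- `rowOf ∘ zOf = id` on `[a, a+N)`. [folklore] -/
theorem rowOf_zOf (a : ℤ) {N : ℕ} [NeZero N] {y : ℤ} (h1 : a ≤ y) (h2 : y < a + N) : rowOf a (zOf a N y) = y := by
  simp only [rowOf, zOf, ZMod.val_intCast]
  rw [Int.emod_eq_of_lt (by omega) (by omega)]
  omega

/-- `zOf` is a shift homomorphism. [folklore] -/
theorem zOf_add_one (a : ℤ) (N : ℕ) (y : ℤ) : zOf a N (y + 1) = zOf a N y + 1 := by simp only [zOf]; push_cast; ring

/-- The seam rows. [folklore] -/
theorem zOf_seam (a : ℤ) (N : ℕ) : zOf a N a = 0 ∧ zOf a N (a + N) = 0 := by constructor <;> simp [zOf]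

/-- Range of `rowOf`. [folklore] -/
theorem rowOf_mem (a : ℤ) {N : ℕ} [NeZero N] (r : ZMod N) : a ≤ rowOf a r ∧ rowOf a r < a + N := by
  have := ZMod.val_lt r; simp only [rowOf]; omega

/-- Cylinder configurations: colours of `Fin 3 × ℤ/N` and flags of `Fin 2 × ℤ/N`. [folklore] -/
abbrev CylCfg (N : ℕ) : Type := (Fin 3 × ZMod N → Bool) × (Fin 2 × ZMod N → Bool)

/-- The cylinder configuration read off the strip rows `[a, a+N)`. [folklore] -/
def cylMap (a : ℤ) (N : ℕ) (τ κ₀ κ₂ : Bool) (b : K) : CylCfg N :=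
  (fun x => col τ κ₀ κ₂ b x.1 (rowOf a x.2), fun f => flag τ b f.1 (rowOf a f.2))

/-- PERIODICITY EVENT of the window `[a, a+N]`, in bits: equal row bits at the two seam rows and even plaquette
parities of both face columns over `[a, a+N)`. [folklore] -/
def Per (a : ℤ) (N : ℕ) : Set K :=
  {b | b (0, a + N) = b (0, a) ∧ bp (fun s => b (1, s)) a (a + N) = false ∧ bp (fun s => b (3, s)) a (a + N) = false}

/-- The periodicity event says: the strip colours at row `a + N` repeat those at row `a`. [folklore] -/
theorem mem_Per_iff (a : ℤ) (N : ℕ) (τ κ₀ κ₂ : Bool) (b : K) :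
    b ∈ Per a N ↔ ∀ j : Fin 3, col τ κ₀ κ₂ b j (a + N) = col τ κ₀ κ₂ b j a := by
  have c1 := bp_chasles (fun s => b (1, s)) 0 a (a + N)
  have c3 := bp_chasles (fun s => b (3, s)) 0 a (a + N)
  cases τ
  · simp only [Per, Set.mem_setOf_eq]
    constructor
    · rintro ⟨hr, h1, h3⟩ j
      fin_cases j
      · simp only [Fin.zero_eta, col_zero, hr]
      · simp only [Fin.mk_one, col_one, kL, Bool.false_eq_true, if_false, c3, h3, hr, Bool.xor_false]
      · simp only [Fin.reduceFinMk, col_two, c1, c3, h1, h3, hr, Bool.xor_false]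
    · intro h
      have h0 := h 0; have h1 := h 1; have h2 := h 2; clear h
      simp only [col_zero, col_one, col_two, kL, Bool.false_eq_true, if_false, c1, c3] at h0 h1 h2
      revert h0 h1 h2
      generalize b (0, a) = r; generalize b (0, a + N) = r'
      generalize bp (fun s => b (1, s)) 0 a = A1; generalize bp (fun s => b (1, s)) a (a + N) = D1
      generalize bp (fun s => b (3, s)) 0 a = A3; generalize bp (fun s => b (3, s)) a (a + N) = D3
      generalize b (4, 1) = c
      revert r r' A1 D1 A3 D3 c κ₀ κ₂; decide
  · simp only [Per, Set.mem_setOf_eq]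
    constructor
    · rintro ⟨hr, h1, h3⟩ j
      fin_cases j
      · simp only [Fin.zero_eta, col_zero, hr]
      · simp only [Fin.mk_one, col_one, kL, if_true, c1, h1, hr, Bool.xor_false]
      · simp only [Fin.reduceFinMk, col_two, c1, c3, h1, h3, hr, Bool.xor_false]
    · intro h
      have h0 := h 0; have h1 := h 1; have h2 := h 2; clear h
      simp only [col_zero, col_one, col_two, kL, if_true, c1, c3] at h0 h1 h2
      revert h0 h1 h2
      generalize b (0, a) = r; generalize b (0, a + N) = r'
      generalize bp (fun s => b (1, s)) 0 a = A1; generalize bp (fun s => b (1, s)) a (a + N) = D1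
      generalize bp (fun s => b (3, s)) 0 a = A3; generalize bp (fun s => b (3, s)) a (a + N) = D3
      generalize b (4, 1) = c
      revert r r' A1 D1 A3 D3 c κ₀ κ₂; decide

/-- THE CYLINDER EVENT: the strip window `[a, a+N]` reads the cylinder configuration `cfg` periodically. [folklore] -/
theorem cyl_event_eq (a : ℤ) (N : ℕ) [NeZero N] (τ κ₀ κ₂ : Bool) (cfg : CylCfg N) :
    {b | cylMap a N τ κ₀ κ₂ b = cfg} ∩ Per a N =
      Wev τ κ₀ κ₂ a (a + N) (fun j y => cfg.1 (j, zOf a N y)) (fun j y => cfg.2 (j, zOf a N y)) := by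
  have hN := NeZero.pos N
  ext b
  rw [Set.mem_inter_iff, mem_Per_iff a N τ κ₀ κ₂]
  simp only [Set.mem_setOf_eq, Wev, cylMap, Prod.ext_iff, funext_iff]
  constructor
  · rintro ⟨⟨hc, hf⟩, hper⟩
    refine ⟨fun j y h1 h2 => ?_, fun j y h1 h2 => ?_⟩
    · rcases lt_or_eq_of_le h2 with h2 | rfl
      · have e := hc (j, zOf a N y); rwa [rowOf_zOf a h1 h2] at e
      · rw [hper j, (zOf_seam a N).2, ← (zOf_seam a N).1]
        have e := hc (j, zOf a N a); rwa [rowOf_zOf a le_rfl (by omega)] at e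
    · have e := hf (j, zOf a N y); rwa [rowOf_zOf a h1 h2] at e
  · rintro ⟨hc, hf⟩
    refine ⟨⟨fun x => ?_, fun f => ?_⟩, fun j => ?_⟩
    · have e := hc x.1 (rowOf a x.2) (rowOf_mem a x.2).1 (rowOf_mem a x.2).2.le
      rwa [zOf_rowOf] at e
    · have e := hf f.1 (rowOf a f.2) (rowOf_mem a f.2).1 (rowOf_mem a f.2).2
      rwa [zOf_rowOf] at e
    · rw [hc j (a + N) (by omega) le_rfl, hc j a le_rfl (by omega), (zOf_seam a N).2, (zOf_seam a N).1]

/-- The normalising constant `K_N = 2^{-(N+2)} (2(1+t))^{-N}` between probabilities and block weights. [folklore] -/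
def KN (N : ℕ) : ℝ := (1 / 2) ^ (N + 2) * (1 / (2 * (1 + Real.sqrt 3 / 2))) ^ N

/-- `K_N ≥ 0`. [folklore] -/
theorem KN_nonneg (N : ℕ) : 0 ≤ KN N := by unfold KN; positivity
/-- Isotropic face weights are `(1+t)/2` times the plaquette Bernoulli masses (`q (1+t) = t`, `(1-q)(1+t) = 1`). [folklore] -/
theorem faceWeight_iso_eq (o fl : Bool) :
    faceWeight true o fl = (1 + Real.sqrt 3 / 2) / 2 * (if o then (qI : ℝ) else 1 - qI) := by
  rw [faceWeight_iso, qI_val.1]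
  have h3 : Real.sqrt 3 * Real.sqrt 3 = 3 := Real.mul_self_sqrt (by norm_num)
  cases o <;> simp only [Bool.false_eq_true, if_false, if_true]
  exacts [by linear_combination (1 / 2 : ℝ) * h3, by linear_combination (-1 / 2 : ℝ) * h3]

/-- Block weights are nonnegative. [folklore] -/
theorem blockWeight_nonneg (N : ℕ) [NeZero N] (τv : Fin 2 → Bool) (c : Fin 3 × ZMod N → Bool) (α : Fin 2 × ZMod N → Bool) :
    0 ≤ blockWeight N τv c α := by
  unfold blockWeight faceWeight
  refine Finset.prod_nonneg fun f _ => ?_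
  split_ifs <;> positivity

/-- Products over `ℤ/N` as products over the strip rows `[a, a+N)`. [folklore] -/
theorem prod_zmod_eq_prod_Ico (a : ℤ) {N : ℕ} [NeZero N] (g : ZMod N → ℝ) :
    ∏ r, g r = ∏ y ∈ Finset.Ico a (a + N), g (zOf a N y) := by
  refine Finset.prod_nbij' (fun r => rowOf a r) (fun y => zOf a N y) (fun r _ => ?_) (fun y _ => Finset.mem_univ _)
    (fun r _ => zOf_rowOf a r) (fun y hy => ?_) (fun r _ => by rw [zOf_rowOf])
  · rw [Finset.mem_Ico]; exact ⟨(rowOf_mem a r).1, (rowOf_mem a r).2⟩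
  · rw [Finset.mem_Ico] at hy; exact rowOf_zOf a hy.1 hy.2

/-- The pattern parities are the cylinder face parities. [folklore] -/
theorem oI_eq_faceOdd (a : ℤ) (N : ℕ) (τ : Bool) (c : Fin 3 × ZMod N → Bool) (y : ℤ) :
    oI τ (fun j y => c (j, zOf a N y)) y = faceOdd N c (isoJ τ, zOf a N y) := by
  cases τ <;> simp [oI, oL, oR, isoJ, faceOdd, zOf_add_one]

/-- THE CYLINDER LAW: the probability that the strip window `[a, a+N] ∋ 0` reads `cfg` periodically is `K_N` times
the block weight of `cfg` for the column types `(τ, ¬τ)` (zero off the anchor constraint). [folklore] -/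
theorem P_cyl (a : ℤ) (N : ℕ) [NeZero N] (τ κ₀ κ₂ : Bool) (ha : a ≤ 0) (haN : 0 ≤ a + N) (cfg : CylCfg N) :
    P ({b | cylMap a N τ κ₀ κ₂ b = cfg} ∩ Per a N) =
      ENNReal.ofReal (KN N * if (cfg.1 (0, zOf a N 0) ^^ cfg.1 (2, zOf a N 0)) = (κ₀ ^^ κ₂)
        then blockWeight N ![τ, !τ] cfg.1 cfg.2 else 0) := by
  rw [cyl_event_eq, P_Wev τ κ₀ κ₂ ha haN]
  by_cases hcond : (cfg.1 (0, zOf a N 0) ^^ cfg.1 (2, zOf a N 0)) = (κ₀ ^^ κ₂)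
  swap
  · rw [if_neg (fun h => hcond h.1), if_neg hcond, mul_zero, ENNReal.ofReal_zero]
  rw [if_pos hcond]
  by_cases hfl : ∀ y, a ≤ y → y < a + N → cfg.2 (hcJ τ, zOf a N y) = true
  swap
  · rw [if_neg (fun h => hfl h.2)]
    push Not at hfl
    obtain ⟨y, -, -, hy⟩ := hfl
    rw [blockWeight_eq_zero_of_hc_main N _ cfg.1 cfg.2 (hcJ τ, zOf a N y) (by cases τ <;> rfl)
      (by simpa using hy), mul_zero, ENNReal.ofReal_zero]
  rw [if_pos ⟨hcond, hfl⟩, prod_Jw τ κ₀ (by omega), show (a + N - a).toNat = N by omega]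
  congr 1
  have hC : (1 / (2 * (1 + Real.sqrt 3 / 2))) * ((1 + Real.sqrt 3 / 2) / 2) = (1 : ℝ) / 4 := by
    have : (0 : ℝ) < 1 + Real.sqrt 3 / 2 := by positivity
    field_simp; ring
  have hiso : ∏ y ∈ Finset.Ico a (a + N), faceWeight true (faceOdd N cfg.1 (isoJ τ, zOf a N y)) (cfg.2 (isoJ τ, zOf a N y)) =
      ((1 + Real.sqrt 3 / 2) / 2) ^ N * ∏ y ∈ Finset.Ico a (a + N), (if oI τ (fun j y => cfg.1 (j, zOf a N y)) y then (qI : ℝ) else 1 - qI) := by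
    rw [Finset.prod_congr rfl fun y _ => faceWeight_iso_eq _ _, Finset.prod_mul_distrib, Finset.prod_const, Int.card_Ico,
      show (a + N - a).toNat = N by omega]
    congr 1
    exact Finset.prod_congr rfl fun y _ => by rw [oI_eq_faceOdd]
  have hhc : ∏ y ∈ Finset.Ico a (a + N), faceWeight false (faceOdd N cfg.1 (hcJ τ, zOf a N y)) (cfg.2 (hcJ τ, zOf a N y)) = 1 := by
    refine Finset.prod_eq_one fun y hy => ?_
    rw [Finset.mem_Ico] at hy
    rw [hfl y hy.1 hy.2, faceWeight_hc_anti]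
  unfold blockWeight KN
  rw [Fintype.prod_prod_type, Fin.prod_univ_two, prod_zmod_eq_prod_Ico a, prod_zmod_eq_prod_Ico a]
  cases τ
  · simp only [Matrix.cons_val_zero, Matrix.cons_val_one, Bool.not_false]
    rw [show (0 : Fin 2) = hcJ false from rfl, show (1 : Fin 2) = isoJ false from rfl, hhc, hiso, one_mul,
      show ((1 : ℝ) / 4) ^ N = (1 / (2 * (1 + Real.sqrt 3 / 2))) ^ N * ((1 + Real.sqrt 3 / 2) / 2) ^ N by
        rw [← mul_pow, hC]]
    ring
  · simp only [Matrix.cons_val_zero, Matrix.cons_val_one, Bool.not_true]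
    rw [show (0 : Fin 2) = isoJ true from rfl, show (1 : Fin 2) = hcJ true from rfl, hhc, hiso, mul_one,
      show ((1 : ℝ) / 4) ^ N = (1 / (2 * (1 + Real.sqrt 3 / 2))) ^ N * ((1 + Real.sqrt 3 / 2) / 2) ^ N by
        rw [← mul_pow, hC]]
    ring

/-- THE CYLINDER LAW for sets of configurations: probabilities of cylinder events (intersected with periodicity) are
`K_N` times block-weight sums. [folklore] -/
theorem P_cylSet (a : ℤ) (N : ℕ) [NeZero N] (τ κ₀ κ₂ : Bool) (ha : a ≤ 0) (haN : 0 ≤ a + N)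
    (F : CylCfg N → Prop) :
    P ({b | F (cylMap a N τ κ₀ κ₂ b)} ∩ Per a N) =
      ENNReal.ofReal (KN N * ∑ cfg ∈ Finset.univ.filter
        (fun cfg : CylCfg N => F cfg ∧ (cfg.1 (0, zOf a N 0) ^^ cfg.1 (2, zOf a N 0)) = (κ₀ ^^ κ₂)),
          blockWeight N ![τ, !τ] cfg.1 cfg.2) := by
  have hdecomp : {b | F (cylMap a N τ κ₀ κ₂ b)} ∩ Per a N =
      ⋃ cfg ∈ Finset.univ.filter (fun cfg : CylCfg N => F cfg), ({b | cylMap a N τ κ₀ κ₂ b = cfg} ∩ Per a N) := by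
    ext b
    simp only [Set.mem_inter_iff, Set.mem_setOf_eq, Set.mem_iUnion, Finset.mem_filter, Finset.mem_univ, true_and,
      exists_prop]
    constructor
    · rintro ⟨hF, hP⟩; exact ⟨_, hF, rfl, hP⟩
    · rintro ⟨cfg, hF, rfl, hP⟩; exact ⟨hF, hP⟩
  have hmeas : ∀ cfg : CylCfg N, MeasurableSet ({b | cylMap a N τ κ₀ κ₂ b = cfg} ∩ Per a N) := fun cfg => by
    rw [cyl_event_eq, Wev_eq τ κ₀ κ₂ ha haN]
    split_ifs
    · exact MeasurableSet.pi (Finset.countable_toSet _) fun j _ => measurableSet_singleton _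
    · exact MeasurableSet.empty
  have hdisj : Set.PairwiseDisjoint (↑(Finset.univ.filter (fun cfg : CylCfg N => F cfg)) : Set (CylCfg N))
      (fun cfg => {b | cylMap a N τ κ₀ κ₂ b = cfg} ∩ Per a N) := by
    intro c1 _ c2 _ hne
    rw [Function.onFun, Set.disjoint_left]
    rintro b ⟨h1, -⟩ ⟨h2, -⟩
    exact hne (h1.symm.trans h2)
  rw [hdecomp, measure_biUnion_finset hdisj (fun cfg _ => hmeas cfg),
    Finset.sum_congr rfl (fun cfg _ => P_cyl a N τ κ₀ κ₂ ha haN cfg),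
    ← ENNReal.ofReal_sum_of_nonneg (fun cfg _ => mul_nonneg (KN_nonneg N)
      (by split_ifs; exacts [blockWeight_nonneg N _ _ _, le_rfl]))]
  congr 1
  rw [← Finset.mul_sum, Finset.sum_filter, Finset.sum_filter]
  congr 1
  refine Finset.sum_congr rfl fun cfg _ => ?_
  by_cases hF : F cfg <;> by_cases hc : (cfg.1 (0, zOf a N 0) ^^ cfg.1 (2, zOf a N 0)) = (κ₀ ^^ κ₂) <;> simp [hF, hc]

/-! ## §7 The pinned identity summed over cylinder events -/

/-- The column triple `(ξ, η, ζ)` of a cylinder colouring. [folklore] -/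
def colEquiv (N : ℕ) : (Fin 3 × ZMod N → Bool) ≃ (ZMod N → Bool) × (ZMod N → Bool) × (ZMod N → Bool) where
  toFun c := (fun r => c (0, r), fun r => c (1, r), fun r => c (2, r))
  invFun t := fun x => (![t.1, t.2.1, t.2.2] : Fin 3 → ZMod N → Bool) x.1 x.2
  left_inv c := by
    funext ⟨j, r⟩
    fin_cases j <;> rfl
  right_inv t := rfl

/-- Pulling a condition on the outer index through a triple sum. [folklore] -/
theorem sum_sum_sum_ite {A B D : Type*} [Fintype A] [Fintype B] [Fintype D] (p : D → Prop) [DecidablePred p]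
    (G : A → B → D → ℝ) :
    ∑ a, ∑ b, ∑ d, (if p d then G a b d else 0) = ∑ d, if p d then ∑ a, ∑ b, G a b d else 0 :=
  calc ∑ a, ∑ b, ∑ d, (if p d then G a b d else 0)
        = ∑ a, ∑ d, ∑ b, (if p d then G a b d else 0) := Finset.sum_congr rfl fun a _ => Finset.sum_comm
    _ = ∑ d, ∑ a, ∑ b, (if p d then G a b d else 0) := Finset.sum_comm
    _ = _ := Finset.sum_congr rfl fun d _ => by split_ifs <;> simp

/-- Block-weight sums over cylinder events `{(ξ, ζ) ∈ C, P ⊆ blockDiagram}` are sums of pinned weights. [folklore] -/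
theorem sum_cyl_eq_pinned {N : ℕ} [NeZero N] (τv : Fin 2 → Bool) (C : (ZMod N → Bool) → (ZMod N → Bool) → Prop)
    (Pp : Set ((Fin 2 × ZMod N) × (Fin 2 × ZMod N))) :
    ∑ cfg ∈ Finset.univ.filter (fun cfg : CylCfg N =>
        C (fun r => cfg.1 (0, r)) (fun r => cfg.1 (2, r)) ∧ Pp ⊆ blockDiagram N cfg.1 cfg.2),
      blockWeight N τv cfg.1 cfg.2 =
    ∑ ξ : ZMod N → Bool, ∑ ζ : ZMod N → Bool, if C ξ ζ then
      ∑ Δ : Set ((Fin 2 × ZMod N) × (Fin 2 × ZMod N)), (if Pp ⊆ Δ then pinnedWeight N τv ξ ζ Δ else 0) else 0 := by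
  rw [Finset.sum_filter, Fintype.sum_prod_type]
  rw [Fintype.sum_equiv (colEquiv N) _ (fun t => ∑ α : Fin 2 × ZMod N → Bool,
      if C (fun r => (colEquiv N).symm t (0, r)) (fun r => (colEquiv N).symm t (2, r)) ∧
          Pp ⊆ blockDiagram N ((colEquiv N).symm t) α
        then blockWeight N τv ((colEquiv N).symm t) α else 0) (fun c => by simp only [Equiv.symm_apply_apply])]
  rw [Fintype.sum_prod_type]
  refine Finset.sum_congr rfl fun ξ _ => ?_
  rw [Fintype.sum_prod_type, Finset.sum_comm]
  refine Finset.sum_congr rfl fun ζ _ => ?_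
  have hs : ∀ η : ZMod N → Bool,
      ((colEquiv N).symm (ξ, η, ζ)) = fun x => (![ξ, η, ζ] : Fin 3 → ZMod N → Bool) x.1 x.2 := fun η => rfl
  have f0 : ∀ η : ZMod N → Bool, (fun r => (![ξ, η, ζ] : Fin 3 → ZMod N → Bool) 0 r) = ξ := fun η => rfl
  have f2 : ∀ η : ZMod N → Bool, (fun r => (![ξ, η, ζ] : Fin 3 → ZMod N → Bool) 2 r) = ζ := fun η => rfl
  simp only [hs, f0, f2]
  by_cases hC : C ξ ζ
  · simp only [hC, true_and, if_true]
    have key : ∀ (η : ZMod N → Bool) (α : Fin 2 × ZMod N → Bool),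
        (if Pp ⊆ blockDiagram N (fun x => (![ξ, η, ζ] : Fin 3 → ZMod N → Bool) x.1 x.2) α
          then blockWeight N τv (fun x => (![ξ, η, ζ] : Fin 3 → ZMod N → Bool) x.1 x.2) α else 0) =
        ∑ Δ : Set ((Fin 2 × ZMod N) × (Fin 2 × ZMod N)), if Pp ⊆ Δ then
          (if blockDiagram N (fun x => (![ξ, η, ζ] : Fin 3 → ZMod N → Bool) x.1 x.2) α = Δ
            then blockWeight N τv (fun x => (![ξ, η, ζ] : Fin 3 → ZMod N → Bool) x.1 x.2) α else 0) else 0 := by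
      intro η α
      rw [Finset.sum_eq_single (blockDiagram N (fun x => (![ξ, η, ζ] : Fin 3 → ZMod N → Bool) x.1 x.2) α)]
      · simp only [if_true]
      · intro Δ _ hne; rw [if_neg (Ne.symm hne), ite_self]
      · intro h; exact absurd (Finset.mem_univ _) h
    simp_rw [key]
    unfold pinnedWeight
    exact sum_sum_sum_ite _ _
  · simp [hC]


/-- EXCHANGE FOR CYLINDER EVENTS: under `DiagramExchangeAt N`, an event of the cylinder read off the strip window
`[a, a+N] ∋ 0` that only constrains the boundary colourings and asks for prescribed boundary connections has the same
probability (jointly with periodicity) for the two column-type orders. [folklore] -/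
theorem P_cyl_exchange {N : ℕ} [NeZero N] (hDX : DiagramExchangeAt N) (a : ℤ) (κ₀ κ₂ : Bool) (ha : a ≤ 0)
    (haN : 0 ≤ a + N) (F : CylCfg N → Prop)
    (hF : ∃ (C : (ZMod N → Bool) → (ZMod N → Bool) → Prop) (Pp : Set ((Fin 2 × ZMod N) × (Fin 2 × ZMod N))),
      ∀ cfg, F cfg ↔ (C (fun r => cfg.1 (0, r)) (fun r => cfg.1 (2, r)) ∧ Pp ⊆ blockDiagram N cfg.1 cfg.2)) :
    P ({b | F (cylMap a N true κ₀ κ₂ b)} ∩ Per a N) = P ({b | F (cylMap a N false κ₀ κ₂ b)} ∩ Per a N) := by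
  obtain ⟨C, Pp, hF⟩ := hF
  rw [P_cylSet a N true κ₀ κ₂ ha haN F, P_cylSet a N false κ₀ κ₂ ha haN F]
  congr 2
  set C' : (ZMod N → Bool) → (ZMod N → Bool) → Prop :=
    fun ξ ζ => C ξ ζ ∧ (ξ (zOf a N 0) ^^ ζ (zOf a N 0)) = (κ₀ ^^ κ₂) with hC'
  have hfilt : Finset.univ.filter (fun cfg : CylCfg N =>
      F cfg ∧ (cfg.1 (0, zOf a N 0) ^^ cfg.1 (2, zOf a N 0)) = (κ₀ ^^ κ₂)) =
      Finset.univ.filter (fun cfg : CylCfg N =>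
        C' (fun r => cfg.1 (0, r)) (fun r => cfg.1 (2, r)) ∧ Pp ⊆ blockDiagram N cfg.1 cfg.2) :=
    Finset.filter_congr fun cfg _ => by rw [hF cfg, hC']; tauto
  rw [hfilt]
  simp only [Bool.not_true, Bool.not_false]
  have key : ∀ τv : Fin 2 → Bool,
      ∑ cfg ∈ Finset.univ.filter (fun cfg : CylCfg N =>
        C' (fun r => cfg.1 (0, r)) (fun r => cfg.1 (2, r)) ∧ Pp ⊆ blockDiagram N cfg.1 cfg.2), blockWeight N τv cfg.1 cfg.2 =
      ∑ ξ : ZMod N → Bool, ∑ ζ : ZMod N → Bool, if C' ξ ζ then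
        ∑ Δ : Set ((Fin 2 × ZMod N) × (Fin 2 × ZMod N)), (if Pp ⊆ Δ then pinnedWeight N τv ξ ζ Δ else 0) else 0 :=
    fun τv => by convert sum_cyl_eq_pinned τv C' Pp
  rw [key, key]
  refine Finset.sum_congr rfl fun ξ _ => Finset.sum_congr rfl fun ζ _ => ?_
  split_ifs
  · exact Finset.sum_congr rfl fun Δ _ => by rw [hDX ξ ζ Δ]
  · rfl

end SDE

/-- EXCHANGE FOR CYLINDER EVENTS READ OFF THE STRIP (part 2 of `stub_StripDiagramExchange`): under
`DiagramExchangeAt N`, a cylinder event that only constrains the boundary colourings and prescribes boundary connections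
has the same probability, jointly with periodicity of the window `[a, a+N] ∋ 0`, for the two column-type orders. [folklore] -/
theorem stripDX_cylExchange : ∀ (N : ℕ) [NeZero N], DiagramExchangeAt N → ∀ (a : ℤ) (κ₀ κ₂ : Bool), a ≤ 0 → 0 ≤ a + N → ∀ (F : SDE.CylCfg N → Prop), (∃ (C : (ZMod N → Bool) → (ZMod N → Bool) → Prop) (Pp : Set ((Fin 2 × ZMod N) × (Fin 2 × ZMod N))), ∀ cfg, F cfg ↔ (C (fun r => cfg.1 (0, r)) (fun r => cfg.1 (2, r)) ∧ Pp ⊆ blockDiagram N cfg.1 cfg.2)) → SDE.P ({b | F (SDE.cylMap a N true κ₀ κ₂ b)} ∩ SDE.Per a N) = SDE.P ({b | F (SDE.cylMap a N false κ₀ κ₂ b)} ∩ SDE.Per a N) :=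
  fun _ _ hDX a κ₀ κ₂ ha haN F hF => SDE.P_cyl_exchange hDX a κ₀ κ₂ ha haN F hF

end Summit.CriticalPhenomena.CardyFormulaZ2.Theorems.IKLinearTransport.PinnedDiagramExchange
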